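import Literature.FieldTheory.ArtinSchreier.PrimeDegree
import Mathlib.FieldTheory.Galois.Basic
import Mathlib.RingTheory.AdjoinRoot
import Mathlib.FieldTheory.SplittingField.IsSplittingField
import Mathlib.FieldTheory.Separable
import HarnessLib

/-!
# The Artin–Schreier extension `K[Z]/(Z^p - Z - c)` (Lang, *Algebra*, VI §6, Thm. 6.4)

Topic `FieldTheory/ArtinSchreier`. Companion of `CyclicDegreeP` / `PrimeDegree` (which prove
Lang VI Thm. 6.4 (i) and (ii): roots, minimal polynomial, irreducibility of `X^p - X - c` for
`c ∉ ℘(K) = {s^p - s}`). This file builds the extension itself as a type and records its Galois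
theory, in the form consumed by the function-field applications (Artin–Schreier coverings of
curves, `Literature.NumberTheory.EllipticCurves.LangTorsor*`):

* `ASExt K p c := AdjoinRoot (X^p - X - C c)` with `[Fact (∀ s : K, s ^ p - s ≠ c)]`; it is a field
  (`X_pow_sub_X_sub_C_irreducible`), of degree `p` over `K` (`finrank_eq`), generated by the class
  `ϑ = AdjoinRoot.root` with `ϑ^p - ϑ = c` (`root_pow_sub_root`);
* `splits_algebraMap` (`X^p - X - c = ∏_{i<p} (X - (ϑ + i))` splits in `ASExt`),
  `isSplittingField`, `separable` (`f' = -1`), hence **`isGalois : IsGalois K (ASExt K p c)`**;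
* **lifting automorphisms of the base**: for a `K₀`-algebra automorphism `τ` of `K` FIXING `c`
  and `i : ℕ`, the `K₀`-algebra automorphism `liftEquiv τ hτ i` of `ASExt K p c` acting as `τ` on
  `K` and sending `ϑ ↦ ϑ + i` (`liftEquiv_algebraMap`, `liftEquiv_root`); with `τ = 1` these are
  the `p` elements of `Gal(ASExt/K)` (`shiftEquiv i : ϑ ↦ ϑ + i`); `eq_and_modEq_of_liftEquiv_eq`:
  `liftEquiv τ i = liftEquiv τ' i'` forces `τ = τ'` and `i ≡ i' (mod p)`.

Everything is proved; no named facts. Mathlib (pinned) has Kummer but no Artin–Schreier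
extensions (`lean search 'ArtinSchreier|X \^ p - X - C'`: only this directory).

## References

* S. Lang, *Algebra*, rev. 3rd ed., GTM 211, Springer 2002, Ch. VI §6, Thm. 6.4. [Lang2002]
* H. Stichtenoth, *Algebraic Function Fields and Codes*, 2nd ed., GTM 254, Prop. 3.7.8
  (Artin–Schreier extensions of function fields). [Stichtenoth2009]
-/

noncomputable section

open Polynomial

namespace Literature.FieldTheory.ArtinSchreier

universe u v

variable (K : Type u) [Field K] (p : ℕ) (c : K)

/-- The Artin–Schreier polynomial `X^p - X - c ∈ K[X]`. [cite: Lang2002, Ch. VI §6 Thm. 6.4] -/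
abbrev asPoly : K[X] := X ^ p - X - C c

/-- `X^p - X - c` is monic. [folklore] -/
theorem monic_asPoly [Fact p.Prime] : (asPoly K p c).Monic := by
  have hp : p.Prime := Fact.out
  rw [show asPoly K p c = X ^ p - (X + C c) by simp only [asPoly, sub_sub]]
  refine monic_X_pow_sub ?_
  calc (X + C c : K[X]).degree = 1 := degree_X_add_C c
    _ < p := by exact_mod_cast hp.one_lt

/-- `deg (X^p - X - c) = p`. [folklore] -/
theorem natDegree_asPoly [Fact p.Prime] : (asPoly K p c).natDegree = p := by
  have hp : p.Prime := Fact.out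
  simp only [asPoly, natDegree_sub_C, FiniteField.X_pow_card_sub_X_natDegree_eq K hp.one_lt]

/-- `X^p - X - c ≠ 0`. [folklore] -/
theorem asPoly_ne_zero [Fact p.Prime] : asPoly K p c ≠ 0 := (monic_asPoly K p c).ne_zero

/-- Under the hypothesis `c ∉ ℘(K)` the Artin–Schreier polynomial is irreducible
(`X_pow_sub_X_sub_C_irreducible`, Lang VI Thm. 6.4 (ii)), as a `Fact` instance for `AdjoinRoot`.
[cite: Lang2002, Ch. VI §6 Thm. 6.4] -/
instance fact_irreducible_asPoly [Fact p.Prime] [CharP K p] [h : Fact (∀ s : K, s ^ p - s ≠ c)] :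
    Fact (Irreducible (asPoly K p c)) :=
  ⟨X_pow_sub_X_sub_C_irreducible p h.out⟩

/-- **The Artin–Schreier extension** `K[Z]/(Z^p - Z - c)` of `K` (a field when `c ∉ ℘(K)`).
[cite: Lang2002, Ch. VI §6 Thm. 6.4] -/
abbrev ASExt : Type u := AdjoinRoot (asPoly K p c)

variable {K p c}

/-- The generator `ϑ` satisfies `ϑ^p - ϑ = c`. [cite: Lang2002, Ch. VI §6 Thm. 6.4] -/
theorem root_pow_sub_root :
    (AdjoinRoot.root (asPoly K p c)) ^ p - AdjoinRoot.root (asPoly K p c) =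
      algebraMap K (ASExt K p c) c := by
  have h := AdjoinRoot.eval₂_root (asPoly K p c)
  simp only [asPoly, eval₂_sub, eval₂_X_pow, eval₂_X, eval₂_C, sub_eq_zero] at h
  rw [h, AdjoinRoot.algebraMap_eq]

variable [Fact p.Prime] [CharP K p] [Fact (∀ s : K, s ^ p - s ≠ c)]

/-- **`[ASExt : K] = p`.** [cite: Lang2002, Ch. VI §6 Thm. 6.4] -/
theorem finrank_eq : Module.finrank K (ASExt K p c) = p := by
  have h := (AdjoinRoot.powerBasis (asPoly_ne_zero K p c)).finrank
  rw [AdjoinRoot.powerBasis_dim, natDegree_asPoly] at h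
  exact h

/-- `ASExt` is finite-dimensional over `K`. [folklore] -/
instance finiteDimensional : FiniteDimensional K (ASExt K p c) :=
  (AdjoinRoot.powerBasis (asPoly_ne_zero K p c)).finite

/-- **`X^p - X - c` splits in `ASExt`**: its roots are the `ϑ + i`, `i < p`
(`X_pow_sub_X_sub_C_eq_prod`). [cite: Lang2002, Ch. VI §6 Thm. 6.4] -/
theorem splits_algebraMap : Splits ((asPoly K p c).map (algebraMap K (ASExt K p c))) := by
  haveI : CharP (ASExt K p c) p := charP_of_injective_algebraMap (algebraMap K _).injective p
  have hmap : (asPoly K p c).map (algebraMap K (ASExt K p c)) =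
      X ^ p - X - C (algebraMap K (ASExt K p c) c) := by
    simp [Polynomial.map_sub, Polynomial.map_pow]
  rw [hmap, X_pow_sub_X_sub_C_eq_prod p root_pow_sub_root]
  refine Splits.multisetProd fun f hf => ?_
  obtain ⟨i, -, rfl⟩ := Multiset.mem_map.1 hf
  exact Splits.X_sub_C _

/-- `ASExt` is a splitting field of `X^p - X - c` over `K` (it is generated by the root `ϑ`).
[cite: Lang2002, Ch. VI §6 Thm. 6.4] -/
instance isSplittingField : IsSplittingField K (ASExt K p c) (asPoly K p c) := by
  refine ⟨splits_algebraMap, ?_⟩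
  rw [eq_top_iff, ← AdjoinRoot.adjoinRoot_eq_top, Algebra.adjoin_le_iff, Set.singleton_subset_iff]
  refine Algebra.subset_adjoin ?_
  rw [mem_rootSet_of_ne (asPoly_ne_zero K p c)]
  simp only [map_sub, map_pow, aeval_X, aeval_C]
  rw [root_pow_sub_root, sub_self]

omit [Fact (∀ s : K, s ^ p - s ≠ c)] in
/-- `X^p - X - c` is separable (`f' = -1` in characteristic `p`). [folklore] -/
theorem separable_asPoly : (asPoly K p c).Separable := by
  have hp : p.Prime := Fact.out
  rw [separable_def]
  simp only [derivative_sub, derivative_X_pow, derivative_X, derivative_C, sub_zero,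
    CharP.cast_eq_zero K p, map_zero, zero_mul, zero_sub]
  exact IsCoprime.neg_right isCoprime_one_right

/-- **`ASExt / K` is Galois** (of degree `p`; its group consists of `ϑ ↦ ϑ + i`, `i ∈ 𝔽_p`).
[cite: Lang2002, Ch. VI §6 Thm. 6.4] -/
instance isGalois : IsGalois K (ASExt K p c) :=
  IsGalois.of_separable_splitting_field (p := asPoly K p c) separable_asPoly

/-! ### Lifting automorphisms of the base which fix `c` -/

section Lift

variable {K₀ : Type v} [Field K₀] [Algebra K₀ K]

/-- For a `K₀`-automorphism `τ` of `K` with `τ c = c` and `i : ℕ`: the ring endomorphism of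
`ASExt K p c` acting as `τ` on `K` and sending `ϑ ↦ ϑ + i` (well defined as `℘(ϑ + i) = ℘(ϑ) = c = τ c`).
[cite: Lang2002, Ch. VI §6 Thm. 6.4] -/
def liftHom (τ : K ≃ₐ[K₀] K) (hτ : τ c = c) (i : ℕ) : ASExt K p c →+* ASExt K p c :=
  AdjoinRoot.lift ((algebraMap K (ASExt K p c)).comp τ.toRingEquiv.toRingHom)
    (AdjoinRoot.root (asPoly K p c) + (i : ASExt K p c)) (by
      haveI : CharP (ASExt K p c) p := charP_of_injective_algebraMap (algebraMap K _).injective p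
      simp only [eval₂_sub, eval₂_X_pow, eval₂_X, eval₂_C, RingHom.comp_apply]
      rw [pow_sub_self_add_natCast p, root_pow_sub_root]
      change _ - algebraMap K (ASExt K p c) (τ c) = 0
      rw [hτ, sub_self])

/-- `liftHom` on `K`. [folklore] -/
@[simp]
theorem liftHom_algebraMap (τ : K ≃ₐ[K₀] K) (hτ : τ c = c) (i : ℕ) (a : K) :
    liftHom τ hτ i (algebraMap K (ASExt K p c) a) = algebraMap K (ASExt K p c) (τ a) := by
  rw [AdjoinRoot.algebraMap_eq, liftHom, AdjoinRoot.lift_of]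
  rfl

/-- `liftHom` on `ϑ`. [folklore] -/
@[simp]
theorem liftHom_root (τ : K ≃ₐ[K₀] K) (hτ : τ c = c) (i : ℕ) :
    liftHom τ hτ i (AdjoinRoot.root (asPoly K p c)) = AdjoinRoot.root (asPoly K p c) + (i : ASExt K p c) :=
  AdjoinRoot.lift_root _

/-- `liftHom` fixes `K₀`. [folklore] -/
theorem liftHom_algebraMap_base (τ : K ≃ₐ[K₀] K) (hτ : τ c = c) (i : ℕ) (a : K₀) :
    liftHom τ hτ i (algebraMap K₀ (ASExt K p c) a) = algebraMap K₀ (ASExt K p c) a := by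
  rw [IsScalarTower.algebraMap_apply K₀ K (ASExt K p c), liftHom_algebraMap, AlgEquiv.commutes]

/-- Two ring endomorphisms of `ASExt` agreeing on `K` and on `ϑ` are equal. [folklore] -/
theorem ringHom_ext {f g : ASExt K p c →+* ASExt K p c}
    (hK : ∀ a : K, f (algebraMap K _ a) = g (algebraMap K _ a))
    (hroot : f (AdjoinRoot.root (asPoly K p c)) = g (AdjoinRoot.root (asPoly K p c))) : f = g :=
  Ideal.Quotient.ringHom_ext (Polynomial.ringHom_ext (fun a => hK a) hroot)

/-- `p - i % p` is a complement of `i` modulo `p`. [folklore] -/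
theorem add_sub_mod_eq (i : ℕ) : i + (p - i % p) = (i / p + 1) * p := by
  have hp : p.Prime := Fact.out
  have h1 := Nat.mod_add_div i p
  have h2 := Nat.mod_lt i hp.pos
  have h3 : (i / p + 1) * p = p * (i / p) + p := by ring
  omega

/-- `liftHom τ⁻¹ (p - i % p) ∘ liftHom τ i = id`. [folklore] -/
theorem liftHom_symm_comp (τ : K ≃ₐ[K₀] K) (hτ : τ c = c) (hτs : τ.symm c = c) (i : ℕ) :
    (liftHom τ.symm hτs (p - i % p)).comp (liftHom τ hτ i) = RingHom.id (ASExt K p c) := by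
  haveI : CharP (ASExt K p c) p := charP_of_injective_algebraMap (algebraMap K _).injective p
  refine ringHom_ext (fun a => ?_) ?_
  · rw [RingHom.comp_apply, liftHom_algebraMap, liftHom_algebraMap, AlgEquiv.symm_apply_apply,
      RingHom.id_apply]
  · rw [RingHom.comp_apply, liftHom_root, map_add, liftHom_root, map_natCast, RingHom.id_apply,
      add_assoc, ← Nat.cast_add, add_comm (p - i % p) i, add_sub_mod_eq, Nat.cast_mul,
      CharP.cast_eq_zero (ASExt K p c) p, mul_zero, add_zero]

/-- `liftHom τ i ∘ liftHom τ⁻¹ (p - i % p) = id`. [folklore] -/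
theorem liftHom_comp_symm (τ : K ≃ₐ[K₀] K) (hτ : τ c = c) (hτs : τ.symm c = c) (i : ℕ) :
    (liftHom τ hτ i).comp (liftHom τ.symm hτs (p - i % p)) = RingHom.id (ASExt K p c) := by
  haveI : CharP (ASExt K p c) p := charP_of_injective_algebraMap (algebraMap K _).injective p
  refine ringHom_ext (fun a => ?_) ?_
  · rw [RingHom.comp_apply, liftHom_algebraMap, liftHom_algebraMap, AlgEquiv.apply_symm_apply,
      RingHom.id_apply]
  · rw [RingHom.comp_apply, liftHom_root, map_add, liftHom_root, map_natCast, RingHom.id_apply,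
      add_assoc, ← Nat.cast_add, add_sub_mod_eq, Nat.cast_mul,
      CharP.cast_eq_zero (ASExt K p c) p, mul_zero, add_zero]

/-- **The lifted automorphism** `liftEquiv τ hτ i : ASExt ≃ₐ[K₀] ASExt`: `τ` on `K`, `ϑ ↦ ϑ + i`
(with inverse `τ⁻¹` on `K`, `ϑ ↦ ϑ + (p - i % p)`). [cite: Lang2002, Ch. VI §6 Thm. 6.4] -/
def liftEquiv (τ : K ≃ₐ[K₀] K) (hτ : τ c = c) (i : ℕ) : ASExt K p c ≃ₐ[K₀] ASExt K p c :=
  have hτs : τ.symm c = c := by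
    conv_lhs => rw [← hτ]
    exact τ.symm_apply_apply c
  AlgEquiv.ofRingEquiv (f := RingEquiv.ofRingHom (liftHom τ hτ i) (liftHom τ.symm hτs (p - i % p))
    (liftHom_comp_symm τ hτ hτs i) (liftHom_symm_comp τ hτ hτs i))
    (fun a => liftHom_algebraMap_base τ hτ i a)

/-- `liftEquiv` as a function is `liftHom`. [folklore] -/
@[simp]
theorem coe_liftEquiv (τ : K ≃ₐ[K₀] K) (hτ : τ c = c) (i : ℕ) (z : ASExt K p c) :
    liftEquiv τ hτ i z = liftHom τ hτ i z :=
  rfl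

/-- `liftEquiv` on `K`. [folklore] -/
theorem liftEquiv_algebraMap (τ : K ≃ₐ[K₀] K) (hτ : τ c = c) (i : ℕ) (a : K) :
    liftEquiv τ hτ i (algebraMap K (ASExt K p c) a) = algebraMap K (ASExt K p c) (τ a) :=
  liftHom_algebraMap τ hτ i a

/-- `liftEquiv` on `ϑ`. [folklore] -/
theorem liftEquiv_root (τ : K ≃ₐ[K₀] K) (hτ : τ c = c) (i : ℕ) :
    liftEquiv τ hτ i (AdjoinRoot.root (asPoly K p c)) = AdjoinRoot.root (asPoly K p c) + (i : ASExt K p c) :=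
  liftHom_root τ hτ i

/-- **Distinct data give distinct automorphisms**: `liftEquiv τ i = liftEquiv τ' i'` forces
`τ = τ'` and `i ≡ i' (mod p)`. [folklore] -/
theorem eq_and_modEq_of_liftEquiv_eq {τ τ' : K ≃ₐ[K₀] K} {hτ : τ c = c} {hτ' : τ' c = c} {i i' : ℕ}
    (h : liftEquiv τ hτ i = liftEquiv τ' hτ' i') : τ = τ' ∧ i ≡ i' [MOD p] := by
  haveI : CharP (ASExt K p c) p := charP_of_injective_algebraMap (algebraMap K _).injective p
  constructor
  · ext a
    have := congrArg (fun e => e (algebraMap K (ASExt K p c) a)) h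
    simp only [liftEquiv_algebraMap] at this
    exact (algebraMap K (ASExt K p c)).injective this
  · have := congrArg (fun e => e (AdjoinRoot.root (asPoly K p c))) h
    simp only [liftEquiv_root, add_right_inj] at this
    exact (CharP.natCast_eq_natCast (ASExt K p c) p).1 this

/-- **The `𝔽_p`-shifts** `ϑ ↦ ϑ + i`: the `p` elements of `Gal(ASExt/K)`.
[cite: Lang2002, Ch. VI §6 Thm. 6.4] -/
abbrev shiftEquiv (i : ℕ) : ASExt K p c ≃ₐ[K] ASExt K p c :=
  liftEquiv (K₀ := K) AlgEquiv.refl rfl i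

end Lift

end Literature.FieldTheory.ArtinSchreier
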